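import Mathlib
import Summits.Ventures.HodgeRepro2.Tier7.Line3.KappaDataOfAdapted
import Summits.Ventures.HodgeRepro2.Tier7.Line3.KappaDataArchRep

/-!
# Tier7/Line3/KappaDataOfAdaptedRep — `KappaData` from the adapted data, v2: archimedean factors at the PINNED
representing pairs with the phase exposed, finite-place data at the κ-LEVEL (seat t7-x1, gen 2; the re-base
closing crit-2's OBJECTION (F) (l. 15450), answering (G) (l. 15466 (2)) and RECORD (c) (l. 15475))

`KappaDataOfAdapted` (p682401) had two typing defects, both crit-2's: (F) the archimedean factors were model integrals
at representing pairs chosen from an existential carrying only the decay — nothing tied the pair to `matO γ`; (G) the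
finite support clauses quantified ONE global representative over all places, whereas the RTF's support condition is
adelic (a local torus translate per place). This module re-bases the composition:
* **`ArchData`**: everything of `AdaptedData` EXCEPT the finite-place clauses (the adapted pair with its descent and
  injectivity, the infinite-place data and signatures, the weight and indices, `a₁`, `b`, the spectral side);
* **`FinKappa`**: the finite-place data at the κ-LEVEL — `v₁`, `S`, `q`, `B`, `hcong / hS / hout` on `|κF γ − κF γ₀|_w`
  over the support — exactly `KappaData`'s finite fields: torus-INVARIANT statements about the double coset, not about
  a representative (this answers (G); `AdaptedData.toFinKappa` below is the bridge from integral GLOBAL representatives);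
* the PINNED representing pairs `repP₂ / repP₃` from L1-p5's `KappaDataArchRep.exists_archFactor_decay_of_sig11_rep`
  (p683715) with the clauses exposed (`repP_conj`, `repP_snd`, `repP_kappa`) and the PHASE exposed as a function
  (`phase₂ / phase₃ : Orb → ℂ`, `normSq_phase`, `mat_repP_fst_eq`) — RECORD (c): the phase is pinned only up to sign, and
  at odd weight the model integral changes sign with it; the true archimedean orbital integral is `ω(c_γ)⁻¹ ×` the model
  integral at `c_γ ψ(matO γ)`, so the displayed compact-place factor `a₁` must carry `ω(c_γ)⁻¹` at the phase of the
  CHOSEN pair — with `phase₂ γ` a definable function, `a₁` can be built from it (the constructor takes `a₁` displayed);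
* the archimedean factors `archFactorP₂ / archFactorP₃` := the model orbital integrals at the pinned pairs, their decays
  (p1's row 677 at THAT pair), and **`kappaDataRep (A : ArchData) (Fk : FinKappa …) (ha_γ₀) (hident) : KappaData`** —
  every archimedean dictionary field of `KappaData` derived, the finite fields taken from `Fk`; the constructor's two
  hypotheses `ha_γ₀` / `hident` are about model integrals at pairs the kernel ties to `ψ(matO γ)`: the real obligation.
p682401's `AdaptedData` / `kappaData` stay as the superseded first draft (`AdaptedData.toArchData` / `toFinKappa` map it
here). NOTHING here proves any field for the real objects (TYPING-CENSUS T7); nothing about (N) or HC_CM; §8(d): NO.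
Blind lane: Mathlib + the HodgeRepro2 prefix only; no sorry; axioms ⊆ {propext, Classical.choice, Quot.sound}.
-/

namespace Summit.Ventures.HodgeRepro2.Tier7.Line3.KappaDataOfAdapted

open NumberField Matrix MeasureTheory Summit.Ventures.HodgeRepro2.T7SupportTwoTorusInvariant
  Summit.Ventures.HodgeRepro2.Tier7.Line3.KappaNatural Summit.Ventures.HodgeRepro2.Tier7.Line3.KappaArchimedean
  Summit.Ventures.HodgeRepro2.Tier7.Line3.KappaPlaces Summit.Ventures.HodgeRepro2.Tier7.Line3.KappaDecay
  Summit.Ventures.HodgeRepro2.Tier7.Line3.DominantSideOfKappa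
  Summit.Ventures.HodgeRepro2.Tier7.Line3.KappaDataArch
  Summit.Ventures.HodgeRepro2.Tier7.Line3.KappaDataArchRep
  Summit.Ventures.HodgeRepro2.Tier7.Line3.KappaDataFinSplit
open Summit.Ventures.HodgeRepro2.T7SupportKappaCartan (dd colBasis)
open Summit.Ventures.HodgeRepro2.T5SU11Unimodular (SU11)
open Summit.Ventures.HodgeRepro2.T5BergmanCoefficient (mat act)
open Summit.Ventures.HodgeRepro2.T5BergmanKTypeMatrix (decayConst)
open Summit.Ventures.HodgeRepro2.T5BergmanParseval (monomialNormSq)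

/-- **THE FINITE-PLACE DATA AT THE κ-LEVEL** (the finite fields of `KappaData`, torus-invariant): the place `v₁` where the
level shrinks, the places `S` with bounded denominators, the congruence at `v₁`, the denominator bounds at `S` and
integrality elsewhere, all on `|κF γ − κF γ₀|_w` over the support. -/
structure FinKappa {K Orb : Type} [Field K] [NumberField K] (κF : Orb → K) (arith : ℕ → Orb → Prop) (γ₀ : Orb) where
  /-- the place where the level shrinks -/
  v₁ : FinitePlace K
  /-- the finite places with bounded denominators -/
  S : Finset (FinitePlace K)
  hv₁S : v₁ ∉ S
  /-- the residue-size parameter at `v₁` -/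
  q : ℝ
  hq : 1 < q
  /-- the denominator bounds at `S` -/
  B : FinitePlace K → ℝ
  hBpos : ∀ w ∈ S, 0 < B w
  /-- the congruence at `v₁` on the support -/
  hcong : ∀ N γ, arith N γ → v₁ (κF γ - κF γ₀) ≤ q⁻¹ ^ N
  /-- bounded denominators at `S` on the support -/
  hS : ∀ N γ, arith N γ → ∀ w ∈ S, w (κF γ - κF γ₀) ≤ B w
  /-- integrality at every other finite place on the support -/
  hout : ∀ N γ, arith N γ → ∀ w, w ∉ S → w ≠ v₁ → w (κF γ - κF γ₀) ≤ 1

/-- **THE ADAPTED DATA WITHOUT THE FINITE-PLACE CLAUSES**: the adapted pair over `E` with its global invariant in `K`,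
the infinite-place data, the weight and indices, the compact-place factor, the finite factors and the spectral side.
Every field is a hypothesis about the real objects (TYPING-CENSUS T7); none is proved here. -/
structure ArchData (E K : Type) [Field E] [Field K] [NumberField K] [Algebra K E]
    (Rep Orb : Type) [DecidableEq Orb] (PA PB : Rep → Prop) where
  /-- the involution of `E` -/
  σ : E →+* E
  /-- the first orthogonal basis: discriminants `d i` -/
  d : Fin 2 → E
  /-- the second orthogonal basis -/
  f : Fin 2 → Fin 2 → E
  /-- the adapted matrices of the double cosets -/
  matO : Orb → Matrix (Fin 2) (Fin 2) E
  /-- the global invariant, descended to `K` -/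
  κF : Orb → K
  hκF : ∀ γ, algebraMap K E (κF γ) = kappa σ d f (matO γ)
  /-- the matrices are isometries of the adapted form -/
  hiso : ∀ γ, IsIsom σ d (matO γ)
  /-- `κF` separates the double cosets (`Orb` = the regular cosets; `RegOrbDescent.κF_injective′`) -/
  hκ : Function.Injective κF
  /-- the dominant double coset -/
  γ₀ : Orb
  /-- the level-`N` support -/
  arith : ℕ → Orb → Prop
  /-- `K` is totally real -/
  hK : ∀ w : InfinitePlace K, w.IsReal
  /-- the two rank-one places -/
  w₂ : InfinitePlace K
  w₃ : InfinitePlace K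
  hw : w₂ ≠ w₃
  /-- an extension of each real embedding to `E`, intertwining the involutions -/
  ψ : InfinitePlace K → (E →+* ℂ)
  hψσ : ∀ w x, ψ w (σ x) = (starRingEnd ℂ) (ψ w x)
  hψK : ∀ w x, ψ w (algebraMap K E x) = w.embedding x
  /-- the real discriminants at each place -/
  r : InfinitePlace K → Fin 2 → ℝ
  s : InfinitePlace K → Fin 2 → ℝ
  hdr : ∀ w i, ψ w (d i) = (r w i : ℂ)
  /-- the signature `(1, 1)` at the two rank-one places -/
  D₂ : Sig11Data (r w₂) (s w₂) (fun j i => ψ w₂ (f j i))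
  D₃ : Sig11Data (r w₃) (s w₃) (fun j i => ψ w₃ (f j i))
  /-- the signature `(2, 0)` at every other place -/
  D₁ : ∀ w, w ≠ w₂ → w ≠ w₃ → Sig20Data (r w) (s w) (fun j i => ψ w (f j i))
  /-- the archimedean weight and the `K`-type / character indices of the model orbital integral -/
  k : ℕ
  hk : 3 ≤ k
  j : ℕ
  n : ℕ
  p : ℤ
  qq : ℤ
  /-- the compact-place factor, bounded (it carries the central character at the phase of the chosen pairs) -/
  a₁ : Orb → ℂ
  C₁ : ℝ
  ha₁ : ∀ γ, ‖a₁ γ‖ ≤ C₁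
  /-- the finite-place factor at level `N` -/
  b : ℕ → Orb → ℂ
  b_support : ∀ N γ, b N γ ≠ 0 → arith N γ
  ε : ℝ
  hε : 0 < ε
  hε' : ε < 1 / 4
  b_bound : ∃ Bb : ℝ, ∀ N γ, arith N γ → ‖b N γ‖ ≤ Bb * (1 + size w₂ w₃ κF (κF γ₀) γ) ^ ε * ‖b N γ₀‖
  b_γ₀ : ∃ N₀ : ℕ, ∀ N ≥ N₀, b N γ₀ ≠ 0
  /-- the spectral side -/
  spec : ℕ → Rep → ℂ
  spec_zero_A : ∀ N π, ¬ PA π → spec N π = 0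
  spec_zero_B : ∀ N π, ¬ PB π → spec N π = 0

namespace ArchData

variable {E K : Type} [Field E] [Field K] [NumberField K] [Algebra K E]
  {Rep Orb : Type} [DecidableEq Orb] {PA PB : Rep → Prop}
  [MeasurableSpace Circle] [BorelSpace Circle] (A : ArchData E K Rep Orb PA PB)

/-- **the pinned representing pairs with their decay** at a rank-one place `w` (L1-p5's
`exists_archFactor_decay_of_sig11_rep`): the pair is the conjugate of `ψ(matO γ)` by a unit phase, with the fixed `h`. -/
theorem exists_rep_pinned {w : InfinitePlace K} (D : Sig11Data (A.r w) (A.s w) (fun j i => A.ψ w (A.f j i))) :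
    ∃ rep : Orb → SU11 × SU11, ∀ γ : Orb,
      (∃ c : ℂ, Complex.normSq c = 1 ∧ mat (rep γ).1 = P (A.r w) * (c • (A.matO γ).map (A.ψ w)) * Q (A.r w)) ∧
      mat (rep γ).2 = phasedColMatrix (A.r w) (A.s w) (fun j i => A.ψ w (A.f j i)) ∧
      kappa (starRingEnd ℂ) dd (colBasis (rep γ).2) (mat (rep γ).1) =
        kappa (starRingEnd ℂ) (fun i => (A.r w i : ℂ)) (fun j i => A.ψ w (A.f j i)) ((A.matO γ).map (A.ψ w)) ∧
      ∀ (k j n : ℕ), 2 ≤ k → ∀ (p q : ℤ),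
        ‖modelOrbital k j n p q (rep γ)‖ ≤
          decayConst k j n * monomialNormSq k n * reAt (A.hK w) (A.κF γ) ^ (-(k : ℝ) / 2) :=
  exists_archFactor_decay_of_sig11_rep A.σ (A.ψ w) A.d A.f A.matO A.κF (A.hK w) (A.hψσ w) (A.hψK w) (A.hdr w) D
    A.hiso A.hκF

/-- the pinned representing pairs at `w₂` -/
noncomputable def repP₂ : Orb → SU11 × SU11 := Classical.choose (A.exists_rep_pinned A.D₂)

/-- the pinned representing pairs at `w₃` -/
noncomputable def repP₃ : Orb → SU11 × SU11 := Classical.choose (A.exists_rep_pinned A.D₃)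

/-- **the pinning clauses at `w₂`**: the first component is the conjugate of `ψ(matO γ)` by a unit phase -/
theorem repP₂_conj (γ : Orb) :
    ∃ c : ℂ, Complex.normSq c = 1 ∧
      mat (A.repP₂ γ).1 = P (A.r A.w₂) * (c • (A.matO γ).map (A.ψ A.w₂)) * Q (A.r A.w₂) :=
  (Classical.choose_spec (A.exists_rep_pinned A.D₂) γ).1

/-- the second component is the FIXED `h` of the place (`phasedColMatrix`), the same for every `γ` -/
theorem repP₂_snd (γ : Orb) :
    mat (A.repP₂ γ).2 = phasedColMatrix (A.r A.w₂) (A.s A.w₂) (fun j i => A.ψ A.w₂ (A.f j i)) :=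
  (Classical.choose_spec (A.exists_rep_pinned A.D₂) γ).2.1

/-- the model invariant of the pair is the adapted invariant of `ψ(matO γ)` -/
theorem repP₂_kappa (γ : Orb) :
    kappa (starRingEnd ℂ) dd (colBasis (A.repP₂ γ).2) (mat (A.repP₂ γ).1) =
      kappa (starRingEnd ℂ) (fun i => (A.r A.w₂ i : ℂ)) (fun j i => A.ψ A.w₂ (A.f j i))
        ((A.matO γ).map (A.ψ A.w₂)) :=
  (Classical.choose_spec (A.exists_rep_pinned A.D₂) γ).2.2.1

/-- **the pinning clauses at `w₃`** -/
theorem repP₃_conj (γ : Orb) :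
    ∃ c : ℂ, Complex.normSq c = 1 ∧
      mat (A.repP₃ γ).1 = P (A.r A.w₃) * (c • (A.matO γ).map (A.ψ A.w₃)) * Q (A.r A.w₃) :=
  (Classical.choose_spec (A.exists_rep_pinned A.D₃) γ).1

/-- the second component at `w₃` is the fixed `h` -/
theorem repP₃_snd (γ : Orb) :
    mat (A.repP₃ γ).2 = phasedColMatrix (A.r A.w₃) (A.s A.w₃) (fun j i => A.ψ A.w₃ (A.f j i)) :=
  (Classical.choose_spec (A.exists_rep_pinned A.D₃) γ).2.1

/-- the invariant identity at `w₃` -/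
theorem repP₃_kappa (γ : Orb) :
    kappa (starRingEnd ℂ) dd (colBasis (A.repP₃ γ).2) (mat (A.repP₃ γ).1) =
      kappa (starRingEnd ℂ) (fun i => (A.r A.w₃ i : ℂ)) (fun j i => A.ψ A.w₃ (A.f j i))
        ((A.matO γ).map (A.ψ A.w₃)) :=
  (Classical.choose_spec (A.exists_rep_pinned A.D₃) γ).2.2.1

/-- **the phase at `w₂`** (RECORD (c)): the unit `c_γ` with `mat (repP₂ γ).1 = P · (c_γ • ψ(matO γ)) · Q` -/
noncomputable def phase₂ (γ : Orb) : ℂ := Classical.choose (A.repP₂_conj γ)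

/-- the phase is a unit -/
theorem normSq_phase₂ (γ : Orb) : Complex.normSq (A.phase₂ γ) = 1 := (Classical.choose_spec (A.repP₂_conj γ)).1

/-- the first component of the pinned pair at `w₂`, with the phase named -/
theorem mat_repP₂_fst_eq (γ : Orb) :
    mat (A.repP₂ γ).1 = P (A.r A.w₂) * (A.phase₂ γ • (A.matO γ).map (A.ψ A.w₂)) * Q (A.r A.w₂) :=
  (Classical.choose_spec (A.repP₂_conj γ)).2

/-- **the phase at `w₃`** -/
noncomputable def phase₃ (γ : Orb) : ℂ := Classical.choose (A.repP₃_conj γ)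

/-- the phase at `w₃` is a unit -/
theorem normSq_phase₃ (γ : Orb) : Complex.normSq (A.phase₃ γ) = 1 := (Classical.choose_spec (A.repP₃_conj γ)).1

/-- the first component of the pinned pair at `w₃`, with the phase named -/
theorem mat_repP₃_fst_eq (γ : Orb) :
    mat (A.repP₃ γ).1 = P (A.r A.w₃) * (A.phase₃ γ • (A.matO γ).map (A.ψ A.w₃)) * Q (A.r A.w₃) :=
  (Classical.choose_spec (A.repP₃_conj γ)).2

/-- the archimedean factor at `w₂`: the model orbital integral at the PINNED pair -/
noncomputable def archFactorP₂ (γ : Orb) : ℂ := modelOrbital A.k A.j A.n A.p A.qq (A.repP₂ γ)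

/-- the archimedean factor at `w₃`: the model orbital integral at the PINNED pair -/
noncomputable def archFactorP₃ (γ : Orb) : ℂ := modelOrbital A.k A.j A.n A.p A.qq (A.repP₃ γ)

/-- the decay constant (made non-negative) -/
noncomputable def decayC : ℝ := |decayConst A.k A.j A.n * monomialNormSq A.k A.n|

/-- the decay of `archFactorP₂` (p1's row 677 at the pinned pair), exponent `k/2` -/
theorem norm_archFactorP₂_le (γ : Orb) :
    ‖A.archFactorP₂ γ‖ ≤ A.decayC * reAt (A.hK A.w₂) (A.κF γ) ^ (-((A.k : ℝ) / 2)) := by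
  have h := (Classical.choose_spec (A.exists_rep_pinned A.D₂) γ).2.2.2 A.k A.j A.n (by linarith [A.hk]) A.p A.qq
  rw [show (-((A.k : ℝ) / 2)) = -(A.k : ℝ) / 2 from (neg_div _ _).symm]
  refine h.trans (mul_le_mul_of_nonneg_right (le_abs_self _) (Real.rpow_nonneg ?_ _))
  exact zero_le_one.trans (one_le_reAt_of_sig11 A.σ (A.ψ A.w₂) A.d A.f A.matO A.κF (A.hK A.w₂) (A.hψσ A.w₂)
    (A.hψK A.w₂) (A.hdr A.w₂) A.D₂ A.hiso A.hκF γ)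

/-- the decay of `archFactorP₃` -/
theorem norm_archFactorP₃_le (γ : Orb) :
    ‖A.archFactorP₃ γ‖ ≤ A.decayC * reAt (A.hK A.w₃) (A.κF γ) ^ (-((A.k : ℝ) / 2)) := by
  have h := (Classical.choose_spec (A.exists_rep_pinned A.D₃) γ).2.2.2 A.k A.j A.n (by linarith [A.hk]) A.p A.qq
  rw [show (-((A.k : ℝ) / 2)) = -(A.k : ℝ) / 2 from (neg_div _ _).symm]
  refine h.trans (mul_le_mul_of_nonneg_right (le_abs_self _) (Real.rpow_nonneg ?_ _))
  exact zero_le_one.trans (one_le_reAt_of_sig11 A.σ (A.ψ A.w₃) A.d A.f A.matO A.κF (A.hK A.w₃) (A.hψσ A.w₃)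
    (A.hψK A.w₃) (A.hdr A.w₃) A.D₃ A.hiso A.hκF γ)

/-- **`KappaData` FROM THE ADAPTED DATA, v2**: the archimedean fields derived (the real values `≥ 1` and `hT` from the
place data, the decays at the PINNED pairs), the finite fields taken at the κ-level from `Fk`; the hypotheses `ha_γ₀`
/ `hident` are about the model integrals at the pinned pairs. -/
noncomputable def kappaDataRep (Fk : FinKappa A.κF A.arith A.γ₀)
    (ha_γ₀ : A.a₁ A.γ₀ * A.archFactorP₂ A.γ₀ * A.archFactorP₃ A.γ₀ ≠ 0)
    (hident : ∀ N, ∑' γ, A.a₁ γ * A.archFactorP₂ γ * A.archFactorP₃ γ * A.b N γ = ∑' π, A.spec N π) :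
    KappaData K Rep Orb PA PB where
  κ := A.κF
  hκ := A.hκ
  γ₀ := A.γ₀
  arith := A.arith
  v₁ := Fk.v₁
  S := Fk.S
  hv₁S := Fk.hv₁S
  q := Fk.q
  hq := Fk.hq
  B := Fk.B
  hBpos := Fk.hBpos
  hcong := Fk.hcong
  hS := Fk.hS
  hout := Fk.hout
  hK := A.hK
  w₂ := A.w₂
  w₃ := A.w₃
  hw := A.hw
  Binf := 1
  hBinf := one_pos
  hT := fun _ γ _ w h₂ h₃ => place_sub_le_one_of_sig20 A.σ (A.ψ w) A.d A.f A.matO A.κF (A.hψσ w)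
    (A.hψK w) (A.hdr w) (A.D₁ w h₂ h₃) A.hiso A.hκF γ A.γ₀
  a₁ := A.a₁
  a₂ := A.archFactorP₂
  a₃ := A.archFactorP₃
  C₁ := A.C₁
  ha₁ := A.ha₁
  one_le_κ₂ := fun γ => one_le_reAt_of_sig11 A.σ (A.ψ A.w₂) A.d A.f A.matO A.κF (A.hK A.w₂) (A.hψσ A.w₂)
    (A.hψK A.w₂) (A.hdr A.w₂) A.D₂ A.hiso A.hκF γ
  one_le_κ₃ := fun γ => one_le_reAt_of_sig11 A.σ (A.ψ A.w₃) A.d A.f A.matO A.κF (A.hK A.w₃) (A.hψσ A.w₃)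
    (A.hψK A.w₃) (A.hdr A.w₃) A.D₃ A.hiso A.hκF γ
  k₂ := A.k
  k₃ := A.k
  hk₂ := A.hk
  hk₃ := A.hk
  C₂ := A.decayC
  C₃ := A.decayC
  hC₂ := abs_nonneg _
  hC₃ := abs_nonneg _
  ha₂ := A.norm_archFactorP₂_le
  ha₃ := A.norm_archFactorP₃_le
  a_γ₀ := ha_γ₀
  ε := A.ε
  hε := A.hε
  hε' := A.hε'
  b := A.b
  b_support := A.b_support
  b_bound := A.b_bound
  b_γ₀ := A.b_γ₀
  spec := A.spec
  spec_zero_A := A.spec_zero_A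
  spec_zero_B := A.spec_zero_B
  identity := hident

/-- **the two-period conclusion from the adapted data, v2**. -/
theorem exists_twoTorus_rep (Fk : FinKappa A.κF A.arith A.γ₀)
    (ha_γ₀ : A.a₁ A.γ₀ * A.archFactorP₂ A.γ₀ * A.archFactorP₃ A.γ₀ ≠ 0)
    (hident : ∀ N, ∑' γ, A.a₁ γ * A.archFactorP₂ γ * A.archFactorP₃ γ * A.b N γ = ∑' π, A.spec N π) :
    ∃ π, PA π ∧ PB π :=
  KappaData.exists_twoTorus_of_kappaData (A.kappaDataRep Fk ha_γ₀ hident)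

end ArchData

/-! ## The first draft's data map here: the matrix support clauses IMPLY the κ-level clauses (one direction) -/

namespace AdaptedData

variable {E K : Type} [Field E] [Field K] [NumberField K] [Algebra K E]
  {Rep Orb : Type} [DecidableEq Orb] {PA PB : Rep → Prop} (A : AdaptedData E K Rep Orb PA PB)

/-- the archimedean part of p682401's `AdaptedData` -/
def toArchData : ArchData E K Rep Orb PA PB where
  σ := A.σ
  d := A.d
  f := A.f
  matO := A.matO
  κF := A.κF
  hκF := A.hκF
  hiso := A.hiso
  hκ := A.hκ
  γ₀ := A.γ₀
  arith := A.arith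
  hK := A.hK
  w₂ := A.w₂
  w₃ := A.w₃
  hw := A.hw
  ψ := A.ψ
  hψσ := A.hψσ
  hψK := A.hψK
  r := A.r
  s := A.s
  hdr := A.hdr
  D₂ := A.D₂
  D₃ := A.D₃
  D₁ := A.D₁
  k := A.k
  hk := A.hk
  j := A.j
  n := A.n
  p := A.p
  qq := A.qq
  a₁ := A.a₁
  C₁ := A.C₁
  ha₁ := A.ha₁
  b := A.b
  b_support := A.b_support
  ε := A.ε
  hε := A.hε
  hε' := A.hε'
  b_bound := A.b_bound
  b_γ₀ := A.b_γ₀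
  spec := A.spec
  spec_zero_A := A.spec_zero_A
  spec_zero_B := A.spec_zero_B

/-- **the matrix support clauses of p682401 give the κ-level clauses** (L1-p5's `KappaDataFinSplit` field forms): the
bridge from integral GLOBAL representatives to `FinKappa` — a sufficient condition, not the adelic support condition
itself (OBJECTION (G)). -/
noncomputable def toFinKappa : FinKappa A.κF A.arith A.γ₀ where
  v₁ := A.v₁
  S := A.S
  hv₁S := A.hv₁S
  q := A.q
  hq := A.hq
  B := A.B
  hBpos := A.B_pos
  hcong := hcong_field_split A.σ (A.abv A.v₁) (A.abv' A.v₁) A.d A.f A.matO A.κF A.v₁ A.arith A.γ₀ (A.habv A.v₁) A.hκF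
    (A.hna A.v₁) (A.hna' A.v₁) (A.hσ' A.v₁) (A.hf_int A.v₁ A.hv₁S).1 (A.hd_int A.v₁ A.hv₁S).1 (A.hf_int A.v₁ A.hv₁S).2
    (A.hd_int A.v₁ A.hv₁S).2 (A.hdisc_unit A.v₁ A.hv₁S) A.hq (A.hγ₀_int A.v₁ A.hv₁S).1 (A.hγ₀_int A.v₁ A.hv₁S).2
    A.hsupp_cong
  hS := fun N γ hγ w hw => hS_field_split A.σ (A.abv w) (A.abv' w) A.d A.f A.matO A.κF w A.arith A.γ₀ (A.habv w) A.hκF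
    (A.hna w) (A.hna' w) (A.hσ' w) (A.hM w hw).le (A.hM w hw).le (A.hf_S w hw).1 (A.hd_S w hw).1 (A.hf_S w hw).2
    (A.hd_S w hw).2 (A.hγ₀_S w hw).1 (A.hγ₀_S w hw).2 (A.hsupp_S w hw) N γ hγ
  hout := fun N γ hγ w hwS hwv => hout_field_split A.σ (A.abv w) (A.abv' w) A.d A.f A.matO A.κF w A.arith A.γ₀
    (A.habv w) A.hκF (A.hna w) (A.hna' w) (A.hσ' w) (A.hf_int w hwS).1 (A.hd_int w hwS).1 (A.hf_int w hwS).2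
    (A.hd_int w hwS).2 (A.hdisc_unit w hwS) (A.hγ₀_int w hwS).1 (A.hγ₀_int w hwS).2 (A.hsupp_int w hwS hwv) N γ hγ

end AdaptedData

end Summit.Ventures.HodgeRepro2.Tier7.Line3.KappaDataOfAdapted
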